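import Mathlib
import HarnessLib

/-!
# Cauchy's coefficient bound for sums of products of one-variable functions (CDT §2.2)

`Literature/Analysis/Complex/DecomposableCauchyBound.lean`. Everything here is PROVED (no
definition, no named fact). In the extrapolation step of F. Calegari, V. Dimitrov, Y. Tang,
*The unbounded denominators conjecture* (J. Amer. Math. Soc. **38** (2025), 627–702;
arXiv:2109.09040), §2.2 (proof of Lemma 2.0.4), the `d`-variable auxiliary function
`H(z) = h(z₁)^D ⋯ h(z_d)^D F(φ(z₁), …, φ(z_d))` is, by the shape (2.5) of `F`, a finite
`ℤ`-linear combination of *products of one-variable holomorphic functions*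
`H(z) = ∑_J a_J ∏_{s=1}^d u_{J,s}(z_s)`, each `u_{J,s}` holomorphic on a neighbourhood of the closed
unit disc. Its `zⁿ`-coefficient is `∑_J a_J ∏_s [z^{n_s}] u_{J,s}`, and the two displays used by
CDT — the "Cauchy upper bound" (2.7), `|[zⁿ]H| ≤ sup_{𝕋^d} |H|`, followed by the triangle
inequality "Every such term is bounded in magnitude on `𝕋^d` by …" — combine into the bound
proved here from the ONE-variable Cauchy estimate alone (Mathlib's
`Complex.norm_iteratedDeriv_le_of_forall_mem_sphere_norm_le`), with no several-variable theory:

* `norm_taylorCoeff_le_of_forall_mem_sphere_norm_le` — `|[zᵏ] u| = |u^{(k)}(0)|/k! ≤ sup_𝕋 |u|`;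
* `norm_sum_prod_taylorCoeff_le` — `|∑_J a_J ∏_s [z^{n_s}] u_{J,s}| ≤ ∑_J |a_J| ∏_s sup_𝕋 |u_{J,s}|`.

## References

* [CalegariDimitrovTang2025] F. Calegari, V. Dimitrov, Y. Tang, The unbounded denominators
  conjecture, J. Amer. Math. Soc. 38 (2025), no. 3, 627–702, §2.2, displays (2.6)–(2.7) and the
  paragraph following them; arXiv:2109.09040.
-/

noncomputable section

open Complex Metric Real Set Filter Topology

namespace Literature.Analysis.Complex

/-- **Cauchy's bound for a Taylor coefficient.** If `u` is complex differentiable on the open disc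
`|z| < R` (`R > 0`), continuous on its closure, and `|u| ≤ C` on `|z| = R`, then the `k`-th Taylor
coefficient `u^{(k)}(0)/k!` of `u` at `0` has modulus `≤ C / R^k`. [folklore] -/
theorem norm_taylorCoeff_le_of_forall_mem_sphere_norm_le {u : ℂ → ℂ} {R C : ℝ} (hR : 0 < R)
    (hu : DiffContOnCl ℂ u (ball 0 R)) (hC : ∀ z ∈ sphere (0 : ℂ) R, ‖u z‖ ≤ C) (k : ℕ) :
    ‖iteratedDeriv k u 0 / k.factorial‖ ≤ C / R ^ k := by
  have h := Complex.norm_iteratedDeriv_le_of_forall_mem_sphere_norm_le k hR hu hC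
  have hk : (0 : ℝ) < k.factorial := by exact_mod_cast k.factorial_pos
  rw [norm_div, Complex.norm_natCast, div_le_iff₀ hk]
  calc ‖iteratedDeriv k u 0‖ ≤ k.factorial * C / R ^ k := h
    _ = C / R ^ k * k.factorial := by ring

/-- **The Cauchy upper bound for a sum of products** (CDT §2.2, (2.7) and the triangle
inequality after it): for finitely many coefficients `a_J` and one-variable functions `u_{J,s}`
(`s = 1, …, d`), each complex differentiable on the open unit disc, continuous on the closed unit
disc and bounded by `B_{J,s} ≥ 0` on the unit circle, and a multi-index `n`,
`|∑_J a_J ∏_s u_{J,s}^{(n_s)}(0)/n_s!| ≤ ∑_J |a_J| ∏_s B_{J,s}` — the `zⁿ`-coefficient of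
`H(z) = ∑_J a_J ∏_s u_{J,s}(z_s)` is bounded by the termwise supremum bound for `sup_{𝕋^d}|H|`.
[cite: CalegariDimitrovTang2025, §2.2, (2.7)] -/
theorem norm_sum_prod_taylorCoeff_le {ι : Type*} (J : Finset ι) {d : ℕ} (a : ι → ℂ)
    (u : ι → Fin d → ℂ → ℂ) (B : ι → Fin d → ℝ) (n : Fin d → ℕ)
    (hu : ∀ j ∈ J, ∀ s, DiffContOnCl ℂ (u j s) (ball 0 1))
    (hB : ∀ j ∈ J, ∀ s, ∀ z ∈ sphere (0 : ℂ) 1, ‖u j s z‖ ≤ B j s) :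
    ‖∑ j ∈ J, a j * ∏ s, iteratedDeriv (n s) (u j s) 0 / (n s).factorial‖ ≤
      ∑ j ∈ J, ‖a j‖ * ∏ s, B j s := by
  refine (norm_sum_le _ _).trans (Finset.sum_le_sum fun j hj ↦ ?_)
  rw [norm_mul, norm_prod]
  refine mul_le_mul_of_nonneg_left (Finset.prod_le_prod (fun s _ ↦ norm_nonneg _) fun s _ ↦ ?_)
    (norm_nonneg _)
  have h := norm_taylorCoeff_le_of_forall_mem_sphere_norm_le one_pos (hu j hj s) (hB j hj s) (n s)
  simpa using h

end Literature.Analysis.Complex
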